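import Mathlib.RingTheory.PowerSeries.Basic
import Mathlib.RingTheory.Valuation.Basic
import Mathlib.NumberTheory.Padics.PadicIntegers
import Mathlib.Data.Nat.Choose.Dvd
import Mathlib.Data.Nat.Choose.Sum
import Literature.NumberTheory.EllipticCurves.IwasawaAlgebra
import HarnessLib

set_option linter.dupNamespace false
set_option autoImplicit false

/-!
# K7r crux `EllipticUnitValueSevenOfGZK` (stmt-BirchSwinnertonDyer-19945), line `rubin-formula-zp`,
# research stub S_open — the two FORMAL inputs of the RELATIVE RUBIN VALUATION THEOREM:
# (1) the ULTRAMETRIC TRANSFER «`F(x) ≡ F(0) (mod x)`» for a power series under any evaluation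
# `X ↦ x`, with its valuation consequences, and (2) the UNIT-POWER VALUATION LEMMA
# `ord((1 + y)^{p^m} − 1) = ord y + m · ord p` (pure commutative algebra; cell `bsd-cm`, seat
# `bsd-cm-k7r-c3` g8; helper, `--supports` 19945)

HONEST FRAMING. Nothing here is about elliptic curves, Hecke characters or `p`-adic `L`-functions;
nothing is asserted about the crux; BSD is not proved by any of this. The cell memo
RELATIVE-RUBIN-ram-g9.md (seat `bsd-cm-ram` g9, evidence #16 on 19945) reads the one open stub S_open
`X12.O11.RamifiedCMRubinFormulaAtZp W 7` of the registered line through a RELATIVE valuation formula: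
for `𝓛 ∈ 𝒪⟦X⟧` ([BKNO] Def. 4.7, `𝒪 = 𝒪_𝔭 = ℤ₇[√−7]`, `γ ↔ 1 + X`) and the de Rham characters
`ξ_k = φ_ac^k`, `k = 7^m`, accumulating at `𝟙`, the bottom valuation `λ₀ = ord_π 𝓛(𝟙) = ord_π 𝓛(0)`
equals `ord_π 𝓛(ξ_k) = ord_π 𝓛(u^k − 1)` as soon as either is `< ord_π(u^k − 1) = 1 + 2m` (memo §1
(vi) + (i)); its §5 records «kernel: NOT typed». This file PROVES the two formal (source-free) steps in
the generality of the tree's currencies (`Valuation` into a `LinearOrderedCommGroupWithZero` — the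
`Valued` completions `K_𝔭`; norm / `PadicInt.valuation` on `ℤ_[p]` — the cell's `IwasawaAlgebra p` and
`Castella2018.AcSelmer.XAc.HasCharValuationAt`):
* §1 `X ∣ F − C(F(0))` in `R⟦X⟧`; hence under ANY ring homomorphism `ev : R⟦X⟧ →+* S` («evaluation
  `X ↦ ev X`») `ev X ∣ ev F − ev (C (F 0))`; algebra-hom form `ev X ∣ ev F − algebraMap (F 0)`.
* §2 VALUATION TRANSFER along `x ∣ a − c` on a `v`-integral ring (`∀ s, v s ≤ 1`), multiplicative
  convention: (c) `v a ≤ max (v c) (v x)`, `v c ≤ max (v a) (v x)`; (a) `v x < v a → v c = v a`;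
  (b) `v x < v c → v a = v c`; and the power-series instances (`a = ev F`, `c = ev (C (F 0))`,
  `x = ev X`) = memo §1 (vi) (a)(b)(c).
* §3 The `ℤ_[p]` instance in norm and `PadicInt.valuation` currency for any `ℤ_[p]`-algebra map
  `ev : IwasawaAlgebra p →ₐ[ℤ_[p]] ℤ_[p]` (Mathlib's `PowerSeries.aeval` at a topologically nilpotent
  point is one; NO evaluation map is constructed here): e.g. `ev F ≠ 0`, `ev X ≠ 0`,
  `(ev F).valuation < (ev X).valuation ⇒ F 0 ≠ 0 ∧ (F 0).valuation = (ev F).valuation`.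
* §4 UNIT-POWER VALUATION LEMMA (Serre, *Local Fields*, Ch. XIV §4, proof of Prop. 9): for a prime
  `p` and `y` with `0 < v y < 1`, `(v y)^(p−1) < v p` (additively `(p − 1)·ord y > e = ord p`):
  `v ((1 + y)^p − 1) = v p · v y`; iterated `v ((1 + y)^(p^m) − 1) = v y · (v p)^m`; the cell's
  instance `v p = (v π)²` (ramification index `2`), `v y = v π`, `p ≥ 5`: `(v π)^(1 + 2m)` — ram g9's
  `ord_π(φ_ac(γ)^{7^m} − 1) = 1 + 2m` (the hypothesis `(p − 1)·1 > 2` is why `p ≥ 5`, [BKNO] §1.2.1).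
NOT here: any `p`-adic `L`-function or de Rham character, the D-independence of periods (memo §1
(iv)), the archimedean identity S_arch — research / planner g21 pen (4); no statement item is filed.
References: J.-P. Serre, *Local Fields*, GTM 67 (1979), Ch. XIV §4 Prop. 9 [Serre1979]; L. Washington,
*Introduction to Cyclotomic Fields*, GTM 83 (1997), §7.2 [Washington1997]; memo RELATIVE-RUBIN-ram-g9.md.
-/

namespace Summit.BirchSwinnertonDyer.BirchSwinnertonDyer.Theorems.RamifiedSevenEllipticUnits.Ultrametric

open PowerSeries Finset

/-! ## §1 Power series: `F ≡ F(0) (mod X)`, and its image under any evaluation -/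

section PowerSeriesDivisibility

variable {R : Type*} [CommRing R] {S : Type*} [CommRing S]

/-- **`X ∣ F − C(F(0))`** in `R⟦X⟧`: a power series is congruent to its constant term modulo `X`
(`PowerSeries.X_dvd_iff`). [cite: Washington1997, §7.2 (power series over `𝒪`; `f ≡ f(0) mod T`)] -/
theorem X_dvd_sub_C_constantCoeff (F : R⟦X⟧) : (X : R⟦X⟧) ∣ F - C (constantCoeff F) := by
  rw [X_dvd_iff, map_sub, constantCoeff_C, sub_self]

/-- **Under any evaluation `ev : R⟦X⟧ →+* S` (`X ↦ x := ev X`): `x ∣ ev F − ev (C (F 0))`** — the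
ring-theoretic form of «`F(x) − F(0) ∈ x · 𝒪`» (memo RELATIVE-RUBIN §1 (vi)); no topology, no
convergence: every ring homomorphism out of `R⟦X⟧` qualifies. [cite: Washington1997, §7.2] -/
theorem eval_X_dvd_eval_sub_eval_C (ev : R⟦X⟧ →+* S) (F : R⟦X⟧) :
    ev X ∣ ev F - ev (C (constantCoeff F)) := by
  simpa only [map_sub] using map_dvd ev (X_dvd_sub_C_constantCoeff F)

/-- Algebra-homomorphism form: for `ev : R⟦X⟧ →ₐ[R] S`, `ev X ∣ ev F − algebraMap R S (F 0)`
(`ev (C r) = algebraMap R S r`). [cite: Washington1997, §7.2] -/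
theorem eval_X_dvd_eval_sub_algebraMap [Algebra R S] (ev : R⟦X⟧ →ₐ[R] S) (F : R⟦X⟧) :
    ev X ∣ ev F - algebraMap R S (constantCoeff F) := by
  have h := eval_X_dvd_eval_sub_eval_C ev.toRingHom F
  simp only [AlgHom.toRingHom_eq_coe, RingHom.coe_coe] at h
  rwa [C_eq_algebraMap, AlgHom.commutes] at h

end PowerSeriesDivisibility

/-! ## §2 Valuation transfer along `x ∣ a − c` on a `v`-integral ring -/

section Transfer

variable {S : Type*} [CommRing S] {Γ₀ : Type*} [LinearOrderedCommGroupWithZero Γ₀]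
  (v : Valuation S Γ₀)

/-- On a `v`-INTEGRAL ring (`v s ≤ 1` for all `s`), `x ∣ a − c` gives `v (a − c) ≤ v x`.
[cite: Serre1979, Ch. II §1 (discrete valuation rings; `v(xy) = v(x) + v(y)`)] -/
theorem map_sub_le_of_dvd (hint : ∀ s : S, v s ≤ 1) {x a c : S} (h : x ∣ a - c) :
    v (a - c) ≤ v x := by
  obtain ⟨q, hq⟩ := h
  rw [hq, map_mul]
  calc v x * v q ≤ v x * 1 := mul_le_mul_right (hint q) _
    _ = v x := mul_one _

/-- **(c) `v a ≤ max (v c) (v x)`** (additively: `ord F(x) ≥ min(ord F(0), ord x)`).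
[cite: Serre1979, Ch. II §1] -/
theorem map_le_max_of_dvd_sub (hint : ∀ s : S, v s ≤ 1) {x a c : S} (h : x ∣ a - c) :
    v a ≤ max (v c) (v x) :=
  calc v a = v (c + (a - c)) := by rw [add_sub_cancel]
    _ ≤ max (v c) (v (a - c)) := v.map_add _ _
    _ ≤ max (v c) (v x) := max_le_max le_rfl (map_sub_le_of_dvd v hint h)

/-- **(c′) `v c ≤ max (v a) (v x)`** (additively: `ord F(0) ≥ min(ord F(x), ord x)`).
[cite: Serre1979, Ch. II §1] -/
theorem map_const_le_max_of_dvd_sub (hint : ∀ s : S, v s ≤ 1) {x a c : S} (h : x ∣ a - c) :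
    v c ≤ max (v a) (v x) :=
  calc v c = v (a - (a - c)) := by rw [sub_sub_cancel]
    _ ≤ max (v a) (v (a - c)) := v.map_sub _ _
    _ ≤ max (v a) (v x) := max_le_max le_rfl (map_sub_le_of_dvd v hint h)

/-- **(a) `v x < v a → v c = v a`** (additively: `ord F(x) < ord x ⇒ ord F(0) = ord F(x)`; in
particular `F(0) ≠ 0` valuatively). [cite: Serre1979, Ch. II §1] -/
theorem map_const_eq_of_lt (hint : ∀ s : S, v s ≤ 1) {x a c : S} (h : x ∣ a - c)
    (hlt : v x < v a) : v c = v a := by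
  have hε : v (a - c) < v a := lt_of_le_of_lt (map_sub_le_of_dvd v hint h) hlt
  calc v c = v (a - (a - c)) := by rw [sub_sub_cancel]
    _ = v a := v.map_sub_eq_of_lt_left hε

/-- **(b) `v x < v c → v a = v c`** (additively: `ord F(0) < ord x ⇒ ord F(x) = ord F(0)`).
[cite: Serre1979, Ch. II §1] -/
theorem map_eq_const_of_lt (hint : ∀ s : S, v s ≤ 1) {x a c : S} (h : x ∣ a - c)
    (hlt : v x < v c) : v a = v c := by
  have hε : v (a - c) < v c := lt_of_le_of_lt (map_sub_le_of_dvd v hint h) hlt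
  calc v a = v (c + (a - c)) := by rw [add_sub_cancel]
    _ = v c := v.map_add_eq_of_lt_left hε

variable {R : Type*} [CommRing R]

/-- **ULTRAMETRIC TRANSFER for power series, (a)**: on a `v`-integral `S`, for any evaluation
`ev : R⟦X⟧ →+* S`, `v (ev X) < v (ev F) → v (ev (C (F 0))) = v (ev F)` — «`ord_π 𝓛(x) < ord_π x ⇒
ord_π 𝓛(0) = ord_π 𝓛(x)`» (memo RELATIVE-RUBIN §1 (vi) (a)). [cite: Washington1997, §7.2] -/
theorem map_eval_C_constantCoeff_eq_of_lt (hint : ∀ s : S, v s ≤ 1) (ev : R⟦X⟧ →+* S) (F : R⟦X⟧)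
    (hlt : v (ev X) < v (ev F)) : v (ev (C (constantCoeff F))) = v (ev F) :=
  map_const_eq_of_lt v hint (eval_X_dvd_eval_sub_eval_C ev F) hlt

/-- **ULTRAMETRIC TRANSFER for power series, (b)**: `v (ev X) < v (ev (C (F 0))) → v (ev F) =
v (ev (C (F 0)))` — «`ord_π 𝓛(0) < ord_π x ⇒ ord_π 𝓛(x) = ord_π 𝓛(0)`» (memo §1 (vi) (b)).
[cite: Washington1997, §7.2] -/
theorem map_eval_eq_of_lt (hint : ∀ s : S, v s ≤ 1) (ev : R⟦X⟧ →+* S) (F : R⟦X⟧)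
    (hlt : v (ev X) < v (ev (C (constantCoeff F)))) : v (ev F) = v (ev (C (constantCoeff F))) :=
  map_eq_const_of_lt v hint (eval_X_dvd_eval_sub_eval_C ev F) hlt

/-- **ULTRAMETRIC TRANSFER for power series, (c)**: `v (ev F) ≤ max (v (ev (C (F 0)))) (v (ev X))`
and symmetrically — «`ord 𝓛(x) ≥ min(ord 𝓛(0), ord x)`» (memo §1 (vi) (c)). [cite: Washington1997, §7.2] -/
theorem map_eval_le_max (hint : ∀ s : S, v s ≤ 1) (ev : R⟦X⟧ →+* S) (F : R⟦X⟧) :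
    v (ev F) ≤ max (v (ev (C (constantCoeff F)))) (v (ev X)) ∧
      v (ev (C (constantCoeff F))) ≤ max (v (ev F)) (v (ev X)) :=
  ⟨map_le_max_of_dvd_sub v hint (eval_X_dvd_eval_sub_eval_C ev F),
    map_const_le_max_of_dvd_sub v hint (eval_X_dvd_eval_sub_eval_C ev F)⟩

/-- Algebra-hom form of (a): for `ev : R⟦X⟧ →ₐ[R] S` on a `v`-integral `S`,
`v (ev X) < v (ev F) → v (algebraMap R S (F 0)) = v (ev F)`. [cite: Washington1997, §7.2] -/
theorem map_algebraMap_constantCoeff_eq_of_lt [Algebra R S] (hint : ∀ s : S, v s ≤ 1)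
    (ev : R⟦X⟧ →ₐ[R] S) (F : R⟦X⟧) (hlt : v (ev X) < v (ev F)) :
    v (algebraMap R S (constantCoeff F)) = v (ev F) :=
  map_const_eq_of_lt v hint (eval_X_dvd_eval_sub_algebraMap ev F) hlt

/-- Algebra-hom form of (b): `v (ev X) < v (algebraMap R S (F 0)) → v (ev F) = v (algebraMap R S (F 0))`.
[cite: Washington1997, §7.2] -/
theorem map_aeval_eq_of_lt [Algebra R S] (hint : ∀ s : S, v s ≤ 1) (ev : R⟦X⟧ →ₐ[R] S)
    (F : R⟦X⟧) (hlt : v (ev X) < v (algebraMap R S (constantCoeff F))) :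
    v (ev F) = v (algebraMap R S (constantCoeff F)) :=
  map_eq_const_of_lt v hint (eval_X_dvd_eval_sub_algebraMap ev F) hlt

end Transfer

/-! ## §3 The Iwasawa-algebra instance `Λ = ℤ_[p]⟦T⟧`: norm and `PadicInt.valuation` currency -/

section Padic

open Literature.NumberTheory.EllipticCurves

variable {p : ℕ} [Fact p.Prime]

/-- In `ℤ_[p]`, `x ∣ a − c` gives `‖a − c‖ ≤ ‖x‖` (every cofactor has norm `≤ 1`). [cite: Serre1979, Ch. II §1] -/
theorem norm_sub_le_of_dvd {x a c : ℤ_[p]} (h : x ∣ a - c) : ‖a - c‖ ≤ ‖x‖ := by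
  obtain ⟨q, hq⟩ := h
  rw [hq, norm_mul]
  calc ‖x‖ * ‖q‖ ≤ ‖x‖ * 1 := mul_le_mul_of_nonneg_left (PadicInt.norm_le_one q) (norm_nonneg x)
    _ = ‖x‖ := mul_one _

/-- For any `ℤ_[p]`-algebra homomorphism `ev : Λ →ₐ[ℤ_[p]] ℤ_[p]` («evaluation at `x := ev T`»):
`ev T ∣ ev F − F(0)` in `ℤ_[p]`. [cite: Washington1997, §7.2] -/
theorem eval_X_dvd_eval_sub_constantCoeff (ev : IwasawaAlgebra p →ₐ[ℤ_[p]] ℤ_[p])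
    (F : IwasawaAlgebra p) : ev X ∣ ev F - constantCoeff F := by
  simpa only [Algebra.algebraMap_self, RingHom.id_apply] using eval_X_dvd_eval_sub_algebraMap ev F

/-- **(c) in `ℤ_[p]`**: `‖ev F‖ ≤ max ‖F 0‖ ‖ev T‖` and `‖F 0‖ ≤ max ‖ev F‖ ‖ev T‖`.
[cite: Washington1997, §7.2] -/
theorem norm_eval_le_max (ev : IwasawaAlgebra p →ₐ[ℤ_[p]] ℤ_[p]) (F : IwasawaAlgebra p) :
    ‖ev F‖ ≤ max ‖constantCoeff F‖ ‖ev X‖ ∧ ‖constantCoeff F‖ ≤ max ‖ev F‖ ‖ev X‖ := by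
  have hle := norm_sub_le_of_dvd (eval_X_dvd_eval_sub_constantCoeff ev F)
  constructor
  · calc ‖ev F‖ = ‖constantCoeff F + (ev F - constantCoeff F)‖ := by rw [add_sub_cancel]
      _ ≤ max ‖constantCoeff F‖ ‖ev F - constantCoeff F‖ := PadicInt.nonarchimedean _ _
      _ ≤ max ‖constantCoeff F‖ ‖ev X‖ := max_le_max le_rfl hle
  · calc ‖constantCoeff F‖ = ‖ev F + -(ev F - constantCoeff F)‖ := by
          rw [← sub_eq_add_neg, sub_sub_cancel]
      _ ≤ max ‖ev F‖ ‖-(ev F - constantCoeff F)‖ := PadicInt.nonarchimedean _ _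
      _ ≤ max ‖ev F‖ ‖ev X‖ := max_le_max le_rfl (by rw [norm_neg]; exact hle)

/-- **(a) in `ℤ_[p]`**: `‖ev T‖ < ‖ev F‖ → ‖F 0‖ = ‖ev F‖` («`ord_p f(x) < ord_p x ⇒ ord_p f(0) =
ord_p f(x)`»). [cite: Washington1997, §7.2] -/
theorem norm_constantCoeff_eq_of_lt (ev : IwasawaAlgebra p →ₐ[ℤ_[p]] ℤ_[p]) (F : IwasawaAlgebra p)
    (hlt : ‖ev X‖ < ‖ev F‖) : ‖constantCoeff F‖ = ‖ev F‖ := by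
  have hε : ‖-(ev F - constantCoeff F)‖ < ‖ev F‖ := by
    rw [norm_neg]
    exact lt_of_le_of_lt (norm_sub_le_of_dvd (eval_X_dvd_eval_sub_constantCoeff ev F)) hlt
  calc ‖constantCoeff F‖ = ‖ev F + -(ev F - constantCoeff F)‖ := by
        rw [← sub_eq_add_neg, sub_sub_cancel]
    _ = max ‖ev F‖ ‖-(ev F - constantCoeff F)‖ := PadicInt.norm_add_eq_max_of_ne (ne_of_gt hε)
    _ = ‖ev F‖ := max_eq_left hε.le

/-- **(b) in `ℤ_[p]`**: `‖ev T‖ < ‖F 0‖ → ‖ev F‖ = ‖F 0‖` («`ord_p f(0) < ord_p x ⇒ ord_p f(x) =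
ord_p f(0)`»). [cite: Washington1997, §7.2] -/
theorem norm_eval_eq_of_lt (ev : IwasawaAlgebra p →ₐ[ℤ_[p]] ℤ_[p]) (F : IwasawaAlgebra p)
    (hlt : ‖ev X‖ < ‖constantCoeff F‖) : ‖ev F‖ = ‖constantCoeff F‖ := by
  have hε : ‖ev F - constantCoeff F‖ < ‖constantCoeff F‖ :=
    lt_of_le_of_lt (norm_sub_le_of_dvd (eval_X_dvd_eval_sub_constantCoeff ev F)) hlt
  calc ‖ev F‖ = ‖constantCoeff F + (ev F - constantCoeff F)‖ := by rw [add_sub_cancel]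
    _ = max ‖constantCoeff F‖ ‖ev F - constantCoeff F‖ :=
        PadicInt.norm_add_eq_max_of_ne (ne_of_gt hε)
    _ = ‖constantCoeff F‖ := max_eq_left hε.le

/-- Norm versus `PadicInt.valuation` for non-zero `p`-adic integers: `‖x‖ < ‖y‖ ↔ y.valuation <
x.valuation`. [cite: Serre1979, Ch. II §1] -/
theorem norm_lt_norm_iff_valuation_lt {x y : ℤ_[p]} (hx : x ≠ 0) (hy : y ≠ 0) :
    ‖x‖ < ‖y‖ ↔ y.valuation < x.valuation := by
  have hp : (1 : ℝ) < p := by exact_mod_cast (Fact.out : p.Prime).one_lt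
  rw [PadicInt.norm_eq_zpow_neg_valuation hx, PadicInt.norm_eq_zpow_neg_valuation hy,
    zpow_lt_zpow_iff_right₀ hp]
  omega

/-- Norm versus `PadicInt.valuation` for non-zero `p`-adic integers: `‖x‖ = ‖y‖ ↔ x.valuation =
y.valuation`. [cite: Serre1979, Ch. II §1] -/
theorem norm_eq_norm_iff_valuation_eq {x y : ℤ_[p]} (hx : x ≠ 0) (hy : y ≠ 0) :
    ‖x‖ = ‖y‖ ↔ x.valuation = y.valuation := by
  have hp : (1 : ℝ) < p := by exact_mod_cast (Fact.out : p.Prime).one_lt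
  rw [PadicInt.norm_eq_zpow_neg_valuation hx, PadicInt.norm_eq_zpow_neg_valuation hy,
    (zpow_right_injective₀ (zero_lt_one.trans hp) hp.ne').eq_iff]
  omega

/-- **(a) in `PadicInt.valuation` currency** (the shape of «`ord_p f(0)`» in
`Castella2018.AcSelmer.XAc.HasCharValuationAt`): if `ev F ≠ 0`, `ev T ≠ 0` (`PadicInt.valuation 0 = 0`
is a junk value, so both are asked) and `(ev F).valuation < (ev T).valuation`, then `F 0 ≠ 0` and
`(F 0).valuation = (ev F).valuation`. [cite: Washington1997, §7.2] -/
theorem constantCoeff_valuation_eq_of_lt (ev : IwasawaAlgebra p →ₐ[ℤ_[p]] ℤ_[p])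
    (F : IwasawaAlgebra p) (hF : ev F ≠ 0) (hX : ev X ≠ 0)
    (hlt : (ev F).valuation < (ev X).valuation) :
    constantCoeff F ≠ 0 ∧ (constantCoeff F).valuation = (ev F).valuation := by
  have hn : ‖constantCoeff F‖ = ‖ev F‖ :=
    norm_constantCoeff_eq_of_lt ev F ((norm_lt_norm_iff_valuation_lt hX hF).2 hlt)
  have h0 : constantCoeff F ≠ 0 := by
    intro h
    rw [h, norm_zero] at hn
    exact hF (norm_eq_zero.1 hn.symm)
  exact ⟨h0, (norm_eq_norm_iff_valuation_eq h0 hF).1 hn⟩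

/-- **(b) in `PadicInt.valuation` currency**: if `F 0 ≠ 0`, `ev T ≠ 0` and `(F 0).valuation <
(ev T).valuation`, then `ev F ≠ 0` and `(ev F).valuation = (F 0).valuation`. [cite: Washington1997, §7.2] -/
theorem eval_valuation_eq_of_lt (ev : IwasawaAlgebra p →ₐ[ℤ_[p]] ℤ_[p]) (F : IwasawaAlgebra p)
    (h0 : constantCoeff F ≠ 0) (hX : ev X ≠ 0)
    (hlt : (constantCoeff F).valuation < (ev X).valuation) :
    ev F ≠ 0 ∧ (ev F).valuation = (constantCoeff F).valuation := by
  have hn : ‖ev F‖ = ‖constantCoeff F‖ :=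
    norm_eval_eq_of_lt ev F ((norm_lt_norm_iff_valuation_lt hX h0).2 hlt)
  have hF : ev F ≠ 0 := by
    intro h
    rw [h, norm_zero] at hn
    exact h0 (norm_eq_zero.1 hn.symm)
  exact ⟨hF, (norm_eq_norm_iff_valuation_eq hF h0).1 hn⟩

end Padic

/-! ## §4 The unit-power valuation lemma `v((1 + y)^{p^m} − 1) = v y · (v p)^m` -/

section UnitPower

variable {S : Type*} [CommRing S] {Γ₀ : Type*} [LinearOrderedCommGroupWithZero Γ₀]
  (v : Valuation S Γ₀)

/-- Natural numbers are `v`-integral: `v n ≤ 1`. [cite: Serre1979, Ch. II §1] -/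
theorem map_natCast_le_one (n : ℕ) : v (n : S) ≤ 1 := by
  induction n with
  | zero => simp
  | succ n ih =>
    rw [Nat.cast_succ]
    exact v.map_add_le ih (le_of_eq v.map_one)

/-- The binomial expansion of `(1 + y)^p − 1` with the linear term split off:
`(1 + y)^p − 1 = p·y + ∑_{2 ≤ i ≤ p} C(p, i) y^i`. [cite: Serre1979, Ch. XIV §4, Prop. 9 (proof)] -/
theorem one_add_pow_sub_one_eq (y : S) {p : ℕ} (hp : 2 ≤ p) :
    (1 + y) ^ p - 1 = (p : S) * y + ∑ i ∈ Ico 2 (p + 1), (p.choose i : S) * y ^ i := by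
  have h := add_pow y 1 p
  simp only [one_pow, mul_one] at h
  rw [add_comm, h, Finset.range_eq_Ico]
  have h01 : Ico 0 (p + 1) = Ico 0 2 ∪ Ico 2 (p + 1) :=
    (Finset.Ico_union_Ico_eq_Ico (Nat.zero_le 2) (by omega)).symm
  rw [h01, Finset.sum_union (Finset.Ico_disjoint_Ico_consecutive 0 2 (p + 1))]
  have h2 : Ico 0 2 = {0, 1} := by decide
  rw [h2, Finset.sum_pair (by norm_num)]
  simp only [pow_zero, Nat.choose_zero_right, Nat.cast_one, one_mul, pow_one, Nat.choose_one_right]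
  have hc : ∀ i ∈ Ico 2 (p + 1), y ^ i * (p.choose i : S) = (p.choose i : S) * y ^ i :=
    fun i _ ↦ mul_comm _ _
  rw [Finset.sum_congr rfl hc]
  ring

/-- Each higher binomial term is STRICTLY smaller than the linear one: for `2 ≤ i ≤ p`, `0 < v y < 1`
and `(v y)^(p−1) < v p`, `v (C(p,i) y^i) < v p · v y`. (For `i < p`, `p ∣ C(p, i)` and `(v y)^i <
v y`; for `i = p`, `(v y)^p = (v y)^(p−1) · v y < v p · v y`.) [cite: Serre1979, Ch. XIV §4, Prop. 9 (proof)] -/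
theorem map_choose_mul_pow_lt {p : ℕ} (hp : p.Prime) {y : S} (hy0 : v y ≠ 0) (hy1 : v y < 1)
    (hyp : v y ^ (p - 1) < v (p : S)) {i : ℕ} (hi : i ∈ Ico 2 (p + 1)) :
    v ((p.choose i : S) * y ^ i) < v (p : S) * v y := by
  rw [Finset.mem_Ico] at hi
  have hy0' : 0 < v y := zero_lt_iff.2 hy0
  rw [map_mul, map_pow]
  rcases Nat.lt_or_ge i p with hip | hip
  · obtain ⟨k, hk⟩ := hp.dvd_choose_self (by omega) hip
    rw [hk, Nat.cast_mul, map_mul]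
    have hpi : v y ^ i < v y := pow_lt_self_of_lt_one₀ hy0' hy1 (by omega)
    have hp0 : v (p : S) ≠ 0 := ne_of_gt (lt_of_le_of_lt zero_le hyp)
    calc v (p : S) * v (k : S) * v y ^ i ≤ v (p : S) * 1 * v y ^ i := by
          gcongr
          exact map_natCast_le_one v k
      _ = v (p : S) * v y ^ i := by rw [mul_one]
      _ < v (p : S) * v y := mul_lt_mul_of_pos_left hpi (zero_lt_iff.2 hp0)
  · have hieq : i = p := by omega
    subst hieq
    rw [Nat.choose_self, Nat.cast_one, map_one, one_mul]
    have : v y ^ i = v y ^ (i - 1) * v y := by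
      rw [← pow_succ, Nat.sub_add_cancel (by omega)]
    rw [this]
    exact mul_lt_mul_of_pos_right hyp hy0'

/-- **UNIT-POWER VALUATION LEMMA, one step**: for a prime `p` and `y` with `0 < v y < 1`,
`(v y)^(p−1) < v p` (additively `(p − 1)·ord y > e = ord p`): `v ((1 + y)^p − 1) = v p · v y`
(«`ord((1+y)^p − 1) = ord y + e`»). [cite: Serre1979, Ch. XIV §4, Prop. 9 (proof)] -/
theorem map_one_add_pow_prime_sub_one {p : ℕ} (hp : p.Prime) {y : S} (hy0 : v y ≠ 0)
    (hy1 : v y < 1) (hyp : v y ^ (p - 1) < v (p : S)) :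
    v ((1 + y) ^ p - 1) = v (p : S) * v y := by
  rw [one_add_pow_sub_one_eq y hp.two_le]
  have hg : v (p : S) * v y ≠ 0 :=
    mul_ne_zero (ne_of_gt (lt_of_le_of_lt zero_le hyp)) hy0
  have hrest : v (∑ i ∈ Ico 2 (p + 1), (p.choose i : S) * y ^ i) < v (p : S) * v y :=
    v.map_sum_lt hg fun i hi ↦ map_choose_mul_pow_lt v hp hy0 hy1 hyp hi
  rw [← map_mul] at hrest ⊢
  exact v.map_add_eq_of_lt_left hrest

/-- **UNIT-POWER VALUATION LEMMA, iterated**: under the same hypotheses,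
`v ((1 + y)^(p^m) − 1) = v y · (v p)^m` for every `m` («`ord((1+y)^{p^m} − 1) = ord y + m·e`»; the
hypotheses are inherited along the tower because `v p ≤ 1`). [cite: Serre1979, Ch. XIV §4, Prop. 9 and Prop. 10 (the filtration `U^{(m+ke)}`)] -/
theorem map_one_add_pow_prime_pow_sub_one {p : ℕ} (hp : p.Prime) {y : S} (hy0 : v y ≠ 0)
    (hy1 : v y < 1) (hyp : v y ^ (p - 1) < v (p : S)) (m : ℕ) :
    v ((1 + y) ^ (p ^ m) - 1) = v y * v (p : S) ^ m := by
  induction m with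
  | zero => simp
  | succ m ih =>
    set z : S := (1 + y) ^ (p ^ m) - 1 with hz
    have hp1 : v (p : S) ≤ 1 := map_natCast_le_one v p
    have hp0 : v (p : S) ≠ 0 := ne_of_gt (lt_of_le_of_lt zero_le hyp)
    have hz0 : v z ≠ 0 := by rw [ih]; exact mul_ne_zero hy0 (pow_ne_zero _ hp0)
    have hzle : v z ≤ v y := by
      rw [ih]
      calc v y * v (p : S) ^ m ≤ v y * 1 := mul_le_mul_right (pow_le_one₀ zero_le hp1) _
        _ = v y := mul_one _
    have hz1 : v z < 1 := lt_of_le_of_lt hzle hy1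
    have hzp : v z ^ (p - 1) < v (p : S) :=
      lt_of_le_of_lt (pow_le_pow_left₀ zero_le hzle _) hyp
    have hstep := map_one_add_pow_prime_sub_one v hp hz0 hz1 hzp
    have hid : (1 + y) ^ (p ^ (m + 1)) - 1 = (1 + z) ^ p - 1 := by
      rw [hz, add_sub_cancel, ← pow_mul, pow_succ]
    rw [hid, hstep, ih, pow_succ, mul_left_comm, mul_comm (v (p : S)) (v (p : S) ^ m)]

/-- **THE CELL'S INSTANCE (ramification index `2`, `p ≥ 5`)**: if `v p = (v π)^2` for some `π` with
`0 < v π < 1` (a uniformiser of a quadratic RAMIFIED extension, e.g. `𝒪_𝔭 = ℤ₇[√−7]`, `π = √−7`) and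
`v y = v π` (e.g. `y = u − 1` for a topological generator `u = φ_ac(γ)` of `N¹ ∩ (1 + 𝔭)`), then for
every `m`: `v ((1 + y)^(p^m) − 1) = (v π)^(1 + 2m)` — ram g9's «`ord_π(φ_ac(γ)^{7^m} − 1) = 1 + 2m`»
(memo RELATIVE-RUBIN §1 (i)). The hypothesis `p ≥ 5` is exactly `(p − 1)·1 > 2`; at `p = 3` the
lemma's strict inequality fails (`(v π)^2 < (v π)^2` is false), matching [BKNO]'s standing `p ≥ 5`.
[cite: Serre1979, Ch. XIV §4, Prop. 9 (proof)] -/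
theorem map_one_add_pow_prime_pow_sub_one_of_ramificationTwo {p : ℕ} (hp : p.Prime) (h5 : 5 ≤ p)
    {π y : S} (hπ0 : v π ≠ 0) (hπ1 : v π < 1) (hpπ : v (p : S) = v π ^ 2) (hy : v y = v π)
    (m : ℕ) : v ((1 + y) ^ (p ^ m) - 1) = v π ^ (1 + 2 * m) := by
  have hy0 : v y ≠ 0 := by rw [hy]; exact hπ0
  have hy1 : v y < 1 := by rw [hy]; exact hπ1
  have hyp : v y ^ (p - 1) < v (p : S) := by
    rw [hy, hpπ]
    exact pow_lt_pow_right_of_lt_one₀ (zero_lt_iff.2 hπ0) hπ1 (by omega)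
  rw [map_one_add_pow_prime_pow_sub_one v hp hy0 hy1 hyp m, hy, hpπ, ← pow_mul, pow_add, pow_one]

end UnitPower

end Summit.BirchSwinnertonDyer.BirchSwinnertonDyer.Theorems.RamifiedSevenEllipticUnits.Ultrametric
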